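import Mathlib
import Literature.Geometry.Lorentzian.Basic
import HarnessLib

/-!
# Route ClusterCompleteness · crux `OmegaLimitMultiKerr` — line `birth`, stub `stub_coneInterp`:
# uniform sup-norm interpolation on truncated cones of `E4`

Helper file for the crux `stmt-FinalStateConjecture-17639`
(`Summit.FinalStateConjecture.FinalStateConjecture.Theses.ClusterCompleteness.OmegaLimitMultiKerr`),
closing the registered stub `stub_coneInterp` of the skeleton `Lines/birth.lean` (the pure-analysis
engine of the ORDER UPGRADE `TameRecursO k 𝒟 → RecursO k 𝒟`).

**Statement.** Assume the one-variable Landau-type endpoint inequality (the neighbouring stub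
`stub_landau`, taken verbatim as a hypothesis): for every `n ≥ 2` there is `C > 0` with
`‖φ'(0)‖ ≤ C (A / T + B T^{n-1})` for every curve `φ` of class `Cⁿ` on `[0, T]` with `‖φ‖ ≤ A`,
`‖φ⁽ⁿ⁾‖ ≤ B` there. Then for every normed space `W`, order `k`, cone length `L > 0`, bound `B`
and `ε > 0` there is `δ > 0` such that: for every `f : E4 → W` of class `C^{k+1}` on an open `Ω`,
every point `x` and unit vector `u` whose truncated cone `x + {w | ‖w‖ ≤ L, ‖w‖ ≤ 2⟪w, u⟫}` lies
in `Ω` and carries `‖f‖ ≤ δ` and `‖Dᵐ f‖ ≤ B` (`m ≤ k + 1`), one has `‖Dʲ f (x)‖ ≤ ε` for all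
`j ≤ k`. This is the crude (non-sharp) sup-norm Gagliardo–Nirenberg interpolation on cones
(Gagliardo 1959, Nirenberg 1959), in `ε`/`δ` form.

**Proof.** Only the case `n = 2` of the hypothesis is used. Induction on the order `j` with
shrinking cone radii `L (k + 1 - j)/(k + 1)`:
* cone algebra: `C = {w | ‖w‖ ≤ 2⟪w, u⟫}` is stable under sums and nonnegative multiples and
  contains `u`; every `v` is the difference `(v + 3‖v‖u) - 3‖v‖u` of two cone vectors of norms
  `≤ 4‖v‖`, `3‖v‖`, so an operator bounded by `η` on cone directions has norm `≤ 7η`;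
* one ray: for `g` of class `C²` along `y + t v` (`t ∈ [0, T]`, `‖v‖ = 1`) with `‖g‖ ≤ A'`,
  `‖D² g‖ ≤ B'` there, the curve `φ(t) = g(y + t v)` has `φ'(0) = Dg(y) v` and `‖φ''‖ ≤ B'`, so
  the hypothesis gives `‖Dg(y) v‖ ≤ C₂ (A'/T + B' T)`;
* step `j → j + 1`: apply the ray estimate to `g = Dʲ f` from the points of the shorter cone in
  the unit cone directions, with `T = min (L/(k+1)) (ε/(14 C₂ B₊))`, `B₊ = max B 1`, and the
  level-`j` smallness `ε T/(14 C₂)`; the rays stay in the longer cone;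
* finally take the minimum of the finitely many `δ`'s and the vertex `w = 0`.
-/

-- D-0017: single-problem summit, `Summit.FinalStateConjecture.FinalStateConjecture.…` by design
set_option linter.dupNamespace false

noncomputable section

open scoped ContDiff Topology
open Set Filter

namespace Summit.FinalStateConjecture.FinalStateConjecture.Theorems.ClusterCompleteness

open Literature.Geometry.Lorentzian

/-- The cone `{w | ‖w‖ ≤ 2⟪w, u⟫}` is stable under addition. [folklore] -/
private theorem coneInterp_cone_add {u w₁ w₂ : E4} (h₁ : ‖w₁‖ ≤ 2 * inner ℝ w₁ u)
    (h₂ : ‖w₂‖ ≤ 2 * inner ℝ w₂ u) : ‖w₁ + w₂‖ ≤ 2 * inner ℝ (w₁ + w₂) u := by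
  rw [inner_add_left]
  exact (norm_add_le _ _).trans (by linarith)

/-- The cone `{w | ‖w‖ ≤ 2⟪w, u⟫}` is stable under nonnegative scaling. [folklore] -/
private theorem coneInterp_cone_smul {u w : E4} {c : ℝ} (hc : 0 ≤ c)
    (h : ‖w‖ ≤ 2 * inner ℝ w u) : ‖c • w‖ ≤ 2 * inner ℝ (c • w) u := by
  rw [norm_smul, real_inner_smul_left, Real.norm_of_nonneg hc]
  calc c * ‖w‖ ≤ c * (2 * inner ℝ w u) := mul_le_mul_of_nonneg_left h hc
    _ = 2 * (c * inner ℝ w u) := by ring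

/-- A unit vector `u` lies in its own cone `{w | ‖w‖ ≤ 2⟪w, u⟫}`. [folklore] -/
private theorem coneInterp_cone_self {u : E4} (hu : ‖u‖ = 1) : ‖u‖ ≤ 2 * inner ℝ u u := by
  rw [real_inner_self_eq_norm_sq, hu]
  norm_num

/-- Operator norm from cone directions: if a continuous linear map `A` on `E4` satisfies
`‖A v‖ ≤ η ‖v‖` for all `v` in the cone of a unit vector `u`, then `‖A‖ ≤ 7η`
(write `v = (v + 3‖v‖u) - 3‖v‖u`, two cone vectors). [folklore] -/
private theorem coneInterp_opNorm_le {V : Type*} [NormedAddCommGroup V] [NormedSpace ℝ V]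
    (A : E4 →L[ℝ] V) {u : E4} (hu : ‖u‖ = 1) {η : ℝ} (hη : 0 ≤ η)
    (hA : ∀ v : E4, ‖v‖ ≤ 2 * inner ℝ v u → ‖A v‖ ≤ η * ‖v‖) : ‖A‖ ≤ 7 * η := by
  refine ContinuousLinearMap.opNorm_le_bound _ (by positivity) fun v => ?_
  have hnq : ‖(3 * ‖v‖) • u‖ = 3 * ‖v‖ := by
    rw [norm_smul, hu, mul_one, Real.norm_of_nonneg (by positivity)]
  have hnp : ‖v + (3 * ‖v‖) • u‖ ≤ 4 * ‖v‖ :=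
    (norm_add_le _ _).trans (by rw [hnq]; linarith)
  have hq : ‖(3 * ‖v‖) • u‖ ≤ 2 * inner ℝ ((3 * ‖v‖) • u) u :=
    coneInterp_cone_smul (by positivity) (coneInterp_cone_self hu)
  have hp : ‖v + (3 * ‖v‖) • u‖ ≤ 2 * inner ℝ (v + (3 * ‖v‖) • u) u := by
    have h1 : inner ℝ (v + (3 * ‖v‖) • u) u = inner ℝ v u + 3 * ‖v‖ := by
      rw [inner_add_left, real_inner_smul_left, real_inner_self_eq_norm_sq, hu]
      ring
    have h2 : -‖v‖ ≤ inner ℝ v u := by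
      have h3 := abs_real_inner_le_norm v u
      rw [hu, mul_one] at h3
      exact neg_le_of_abs_le h3
    rw [h1]
    linarith
  calc ‖A v‖ = ‖A (v + (3 * ‖v‖) • u) - A ((3 * ‖v‖) • u)‖ := by
        rw [← map_sub, add_sub_cancel_right]
    _ ≤ ‖A (v + (3 * ‖v‖) • u)‖ + ‖A ((3 * ‖v‖) • u)‖ := norm_sub_le _ _
    _ ≤ η * ‖v + (3 * ‖v‖) • u‖ + η * ‖(3 * ‖v‖) • u‖ := add_le_add (hA _ hp) (hA _ hq)
    _ ≤ η * (4 * ‖v‖) + η * (3 * ‖v‖) :=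
        add_le_add (mul_le_mul_of_nonneg_left hnp hη) (by rw [hnq])
    _ = 7 * η * ‖v‖ := by ring

/-- `‖Dʲ (Dˡ f)(x)‖ = ‖D^{l+j} f (x)‖` (curry isometries; same statement as the tree's
`Literature.Analysis.FluidPDE.norm_iteratedFDeriv_iteratedFDeriv`, restated so that this file
does not depend on the fluid-PDE literature tree). [folklore] -/
private theorem coneInterp_norm_iteratedFDeriv_iteratedFDeriv {V W : Type*} [NormedAddCommGroup V]
    [NormedSpace ℝ V] [NormedAddCommGroup W] [NormedSpace ℝ W] (f : V → W) (j l : ℕ) (x : V) :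
    ‖iteratedFDeriv ℝ j (iteratedFDeriv ℝ l f) x‖ = ‖iteratedFDeriv ℝ (l + j) f x‖ := by
  induction j generalizing l with
  | zero => simp
  | succ j ih =>
    rw [← norm_iteratedFDeriv_fderiv, fderiv_iteratedFDeriv,
      LinearIsometryEquiv.norm_iteratedFDeriv_comp_left, ih (l + 1), Nat.add_right_comm,
      Nat.add_assoc]

/-- **Ray estimate.** Let `C` satisfy the one-variable endpoint inequality at order `2`
(`‖φ'(0)‖ ≤ C (A/T + B T)` for `C²` curves on `[0, T]` with `‖φ‖ ≤ A`, `‖φ''‖ ≤ B`). If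
`g : E4 → V` is `C²` at every point of the segment `y + t v`, `t ∈ [0, T]` (`‖v‖ = 1`), with
`‖g‖ ≤ A` and `‖D² g‖ ≤ B` there, then `‖Dg(y) v‖ ≤ C (A/T + B T)` (chain rule for
`φ(t) = g(y + t v)`: `φ'(s) = Dg(y + s v) v`, `φ''(t) = D²g(y + t v)(v, v)`). [folklore] -/
private theorem coneInterp_ray {V : Type} [NormedAddCommGroup V] [NormedSpace ℝ V] {C : ℝ}
    (hC : ∀ (W : Type) [NormedAddCommGroup W] [NormedSpace ℝ W] (φ : ℝ → W) (T A B : ℝ),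
      0 < T → (∀ t ∈ Set.Icc (0 : ℝ) T, ContDiffAt ℝ 2 φ t) →
        (∀ t ∈ Set.Icc (0 : ℝ) T, ‖φ t‖ ≤ A) →
        (∀ t ∈ Set.Icc (0 : ℝ) T, ‖iteratedDeriv 2 φ t‖ ≤ B) →
        ‖deriv φ 0‖ ≤ C * (A / T + B * T))
    (g : E4 → V) (y v : E4) (hv : ‖v‖ = 1) {T A B : ℝ} (hT : 0 < T)
    (hg : ∀ t ∈ Icc (0 : ℝ) T, ContDiffAt ℝ 2 g (y + t • v))
    (hA : ∀ t ∈ Icc (0 : ℝ) T, ‖g (y + t • v)‖ ≤ A)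
    (hB : ∀ t ∈ Icc (0 : ℝ) T, ‖iteratedFDeriv ℝ 2 g (y + t • v)‖ ≤ B) :
    ‖fderiv ℝ g y v‖ ≤ C * (A / T + B * T) := by
  -- the affine ray and its derivative
  have hℓ : ∀ t : ℝ, HasDerivAt (fun s : ℝ => y + s • v) v t := fun t => by
    simpa using ((hasDerivAt_id' t).smul_const v).const_add y
  have hℓC : ∀ t : ℝ, ContDiffAt ℝ 2 (fun s : ℝ => y + s • v) t := fun t =>
    contDiffAt_const.add (contDiffAt_id.smul contDiffAt_const)
  -- the curve `φ` and its first derivative where `g` is differentiable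
  have hφd : ∀ s : ℝ, DifferentiableAt ℝ g (y + s • v) →
      HasDerivAt (fun t : ℝ => g (y + t • v)) (fderiv ℝ g (y + s • v) v) s := fun s hs =>
    hs.hasFDerivAt.comp_hasDerivAt_of_eq s (hℓ s) rfl
  have hφC : ∀ t ∈ Icc (0 : ℝ) T, ContDiffAt ℝ 2 (fun t : ℝ => g (y + t • v)) t :=
    fun t ht => (hg t ht).comp t (hℓC t)
  -- second derivative along the ray
  have hφ2 : ∀ t ∈ Icc (0 : ℝ) T, ‖iteratedDeriv 2 (fun t : ℝ => g (y + t • v)) t‖ ≤ B := by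
    intro t₀ ht₀
    have hg₀ : ContDiffAt ℝ 2 g (y + t₀ • v) := hg t₀ ht₀
    -- `g` is differentiable near `y + t₀ • v`, hence `φ' = Dg(y + s v) v` near `t₀`
    have hev : ∀ᶠ z in 𝓝 (y + t₀ • v), DifferentiableAt ℝ g z :=
      (hg₀.eventually (by simp)).mono fun z hz => hz.differentiableAt (by simp)
    have hev' : ∀ᶠ s in 𝓝 t₀, DifferentiableAt ℝ g (y + s • v) :=
      (hℓ t₀).continuousAt.eventually hev
    have hderiv : deriv (fun t : ℝ => g (y + t • v)) =ᶠ[𝓝 t₀]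
        fun s => fderiv ℝ g (y + s • v) v :=
      hev'.mono fun s hs => (hφd s hs).deriv
    -- derivative of `s ↦ Dg(y + s v) v` at `t₀`
    have hG : HasFDerivAt (fderiv ℝ g) (fderiv ℝ (fderiv ℝ g) (y + t₀ • v)) (y + t₀ • v) :=
      ((hg₀.fderiv_right (m := 1) (by norm_num)).differentiableAt one_ne_zero).hasFDerivAt
    have hGℓ : HasDerivAt (fun s : ℝ => fderiv ℝ g (y + s • v))
        (fderiv ℝ (fderiv ℝ g) (y + t₀ • v) v) t₀ :=
      hG.comp_hasDerivAt_of_eq t₀ (hℓ t₀) rfl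
    have hGℓv : HasDerivAt (fun s : ℝ => fderiv ℝ g (y + s • v) v)
        (fderiv ℝ (fderiv ℝ g) (y + t₀ • v) v v) t₀ := by
      simpa using hGℓ.clm_apply (hasDerivAt_const t₀ v)
    have h2 : iteratedDeriv 2 (fun t : ℝ => g (y + t • v)) t₀ =
        fderiv ℝ (fderiv ℝ g) (y + t₀ • v) v v := by
      rw [iteratedDeriv_succ, iteratedDeriv_one, hderiv.deriv_eq, hGℓv.deriv]
    -- norm bound through the second iterated derivative
    have h3 := (iteratedFDeriv ℝ 2 g (y + t₀ • v)).le_opNorm ![v, v]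
    rw [Fin.prod_univ_two, iteratedFDeriv_two_apply] at h3
    simp only [Matrix.cons_val_zero, Matrix.cons_val_one, Matrix.cons_val_fin_one, hv,
      mul_one] at h3
    rw [h2]
    exact h3.trans (hB t₀ ht₀)
  -- first derivative at the endpoint
  have h0 : deriv (fun t : ℝ => g (y + t • v)) 0 = fderiv ℝ g y v := by
    have hd : DifferentiableAt ℝ g (y + (0 : ℝ) • v) :=
      (hg 0 ⟨le_rfl, hT.le⟩).differentiableAt (by simp)
    rw [(hφd 0 hd).deriv, zero_smul, add_zero]
  rw [← h0]
  exact hC V (fun t : ℝ => g (y + t • v)) T A B hT hφC hA hφ2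

/-- **Induction step `j → j + 1`.** In the setting of `stub_coneInterp` (order `k`, cone length
`L`, bound `B`, the order-`2` endpoint inequality with constant `C > 0`), suppose that for every
`ε > 0` some `δ > 0` forces `‖Dʲ f‖ ≤ ε` on the truncated cone of radius `R'` whenever the cone
hypothesis holds with smallness `δ`. If `j + 1 ≤ k`, `0 < τ`, `R + τ ≤ R' ≤ L`, the same holds
for `D^{j+1} f` on the truncated cone of radius `R` (ray estimate from each point of the short
cone in the unit cone directions with `T = min τ (ε / (14 C B₊))`, `B₊ = max B 1`, then the
operator norm from cone directions). [folklore] -/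
private theorem coneInterp_succ {W : Type} [NormedAddCommGroup W] [NormedSpace ℝ W] {C : ℝ}
    (hC0 : 0 < C)
    (hC : ∀ (V : Type) [NormedAddCommGroup V] [NormedSpace ℝ V] (φ : ℝ → V) (T A B : ℝ),
      0 < T → (∀ t ∈ Set.Icc (0 : ℝ) T, ContDiffAt ℝ 2 φ t) →
        (∀ t ∈ Set.Icc (0 : ℝ) T, ‖φ t‖ ≤ A) →
        (∀ t ∈ Set.Icc (0 : ℝ) T, ‖iteratedDeriv 2 φ t‖ ≤ B) →
        ‖deriv φ 0‖ ≤ C * (A / T + B * T))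
    {k j : ℕ} (hjk : j + 1 ≤ k) {L B R R' τ : ℝ} (hτ : 0 < τ) (hRR' : R + τ ≤ R') (hR'L : R' ≤ L)
    (IH : ∀ ε : ℝ, 0 < ε → ∃ δ : ℝ, 0 < δ ∧ ∀ (f : E4 → W) (Ω : Set E4) (x u : E4), IsOpen Ω →
      ContDiffOn ℝ (k + 1) f Ω → ‖u‖ = 1 →
        (∀ w : E4, ‖w‖ ≤ L → ‖w‖ ≤ 2 * inner ℝ w u →
          x + w ∈ Ω ∧ ‖f (x + w)‖ ≤ δ ∧ ∀ m ≤ k + 1, ‖iteratedFDeriv ℝ m f (x + w)‖ ≤ B) →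
        ∀ w : E4, ‖w‖ ≤ R' → ‖w‖ ≤ 2 * inner ℝ w u → ‖iteratedFDeriv ℝ j f (x + w)‖ ≤ ε) :
    ∀ ε : ℝ, 0 < ε → ∃ δ : ℝ, 0 < δ ∧ ∀ (f : E4 → W) (Ω : Set E4) (x u : E4), IsOpen Ω →
      ContDiffOn ℝ (k + 1) f Ω → ‖u‖ = 1 →
        (∀ w : E4, ‖w‖ ≤ L → ‖w‖ ≤ 2 * inner ℝ w u →
          x + w ∈ Ω ∧ ‖f (x + w)‖ ≤ δ ∧ ∀ m ≤ k + 1, ‖iteratedFDeriv ℝ m f (x + w)‖ ≤ B) →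
        ∀ w : E4, ‖w‖ ≤ R → ‖w‖ ≤ 2 * inner ℝ w u →
          ‖iteratedFDeriv ℝ (j + 1) f (x + w)‖ ≤ ε := by
  intro ε hε
  have hBp : 0 < max B 1 := lt_max_of_lt_right one_pos
  set T : ℝ := min τ (ε / (14 * C * max B 1)) with hTdef
  have hT : 0 < T := lt_min hτ (by positivity)
  have hTτ : T ≤ τ := min_le_left _ _
  have hTε : T ≤ ε / (14 * C * max B 1) := min_le_right _ _
  obtain ⟨δ, hδ, hIH⟩ := IH (ε * T / (14 * C)) (by positivity)
  refine ⟨δ, hδ, fun f Ω x u hΩ hf hu hcone w hw hwu => ?_⟩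
  -- the ray estimate in every unit cone direction
  have hray : ∀ v : E4, ‖v‖ = 1 → ‖v‖ ≤ 2 * inner ℝ v u →
      ‖fderiv ℝ (iteratedFDeriv ℝ j f) (x + w) v‖ ≤ ε / 7 := by
    intro v hv hvu
    -- the ray `w + t v`, `t ∈ [0, T]`, stays in the truncated cone of radius `R' ≤ L`
    have hmem : ∀ t ∈ Icc (0 : ℝ) T,
        ‖w + t • v‖ ≤ R' ∧ ‖w + t • v‖ ≤ 2 * inner ℝ (w + t • v) u := by
      intro t ht
      refine ⟨?_, coneInterp_cone_add hwu (coneInterp_cone_smul ht.1 hvu)⟩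
      calc ‖w + t • v‖ ≤ ‖w‖ + ‖t • v‖ := norm_add_le _ _
        _ = ‖w‖ + t := by rw [norm_smul, Real.norm_of_nonneg ht.1, hv, mul_one]
        _ ≤ R + τ := add_le_add hw (ht.2.trans hTτ)
        _ ≤ R' := hRR'
    have hbig : ∀ t ∈ Icc (0 : ℝ) T, x + (w + t • v) ∈ Ω ∧ ‖f (x + (w + t • v))‖ ≤ δ ∧
        ∀ m ≤ k + 1, ‖iteratedFDeriv ℝ m f (x + (w + t • v))‖ ≤ B :=
      fun t ht => hcone _ ((hmem t ht).1.trans hR'L) (hmem t ht).2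
    have key : ‖fderiv ℝ (iteratedFDeriv ℝ j f) (x + w) v‖ ≤
        C * (ε * T / (14 * C) / T + max B 1 * T) := by
      refine coneInterp_ray hC (iteratedFDeriv ℝ j f) (x + w) v hv hT ?_ ?_ ?_
      · intro t ht
        rw [add_assoc]
        exact (hf.contDiffAt (hΩ.mem_nhds (hbig t ht).1)).iteratedFDeriv_right (i := j) (m := 2)
          (by exact_mod_cast (show 2 + j ≤ k + 1 by omega))
      · intro t ht
        rw [add_assoc]
        exact hIH f Ω x u hΩ hf hu hcone _ (hmem t ht).1 (hmem t ht).2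
      · intro t ht
        rw [add_assoc, coneInterp_norm_iteratedFDeriv_iteratedFDeriv]
        exact ((hbig t ht).2.2 (j + 2) (by omega)).trans (le_max_left _ _)
    calc ‖fderiv ℝ (iteratedFDeriv ℝ j f) (x + w) v‖
        ≤ C * (ε * T / (14 * C) / T + max B 1 * T) := key
      _ ≤ C * (ε * T / (14 * C) / T + max B 1 * (ε / (14 * C * max B 1))) := by gcongr
      _ = ε / 7 := by
        field_simp
        ring
  -- homogeneity: the bound on all cone vectors
  have hall : ∀ v : E4, ‖v‖ ≤ 2 * inner ℝ v u →
      ‖fderiv ℝ (iteratedFDeriv ℝ j f) (x + w) v‖ ≤ ε / 7 * ‖v‖ := by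
    intro v hvu
    rcases eq_or_ne v 0 with rfl | hv0
    · simp
    have hvpos : 0 < ‖v‖ := norm_pos_iff.2 hv0
    have h1 : ‖‖v‖⁻¹ • v‖ = 1 := by
      rw [norm_smul, norm_inv, norm_norm, inv_mul_cancel₀ hvpos.ne']
    have h2 := hray (‖v‖⁻¹ • v) h1 (coneInterp_cone_smul (inv_nonneg.2 hvpos.le) hvu)
    rw [map_smul, norm_smul, norm_inv, norm_norm] at h2
    calc ‖fderiv ℝ (iteratedFDeriv ℝ j f) (x + w) v‖ ≤ ‖v‖ * (ε / 7) :=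
          (inv_mul_le_iff₀ hvpos).1 h2
      _ = ε / 7 * ‖v‖ := mul_comm _ _
  rw [← norm_fderiv_iteratedFDeriv]
  calc ‖fderiv ℝ (iteratedFDeriv ℝ j f) (x + w)‖ ≤ 7 * (ε / 7) :=
        coneInterp_opNorm_le _ hu (by positivity) hall
    _ = ε := by ring

/-- **All levels.** In the setting of `stub_coneInterp`, for every `j ≤ k` and `ε > 0` there is
`δ > 0` forcing `‖Dʲ f (x + w)‖ ≤ ε` on the truncated cone of radius `L (k + 1 - j)/(k + 1)`
whenever the cone hypothesis holds with smallness `δ` (induction on `j` by `coneInterp_succ`,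
budget `L/(k + 1)` per order; `j = 0` is the hypothesis itself). [folklore] -/
private theorem coneInterp_level {W : Type} [NormedAddCommGroup W] [NormedSpace ℝ W] {C : ℝ}
    (hC0 : 0 < C)
    (hC : ∀ (V : Type) [NormedAddCommGroup V] [NormedSpace ℝ V] (φ : ℝ → V) (T A B : ℝ),
      0 < T → (∀ t ∈ Set.Icc (0 : ℝ) T, ContDiffAt ℝ 2 φ t) →
        (∀ t ∈ Set.Icc (0 : ℝ) T, ‖φ t‖ ≤ A) →
        (∀ t ∈ Set.Icc (0 : ℝ) T, ‖iteratedDeriv 2 φ t‖ ≤ B) →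
        ‖deriv φ 0‖ ≤ C * (A / T + B * T))
    (k : ℕ) {L : ℝ} (hL : 0 < L) (B : ℝ) :
    ∀ j : ℕ, j ≤ k → ∀ ε : ℝ, 0 < ε → ∃ δ : ℝ, 0 < δ ∧
      ∀ (f : E4 → W) (Ω : Set E4) (x u : E4), IsOpen Ω → ContDiffOn ℝ (k + 1) f Ω → ‖u‖ = 1 →
        (∀ w : E4, ‖w‖ ≤ L → ‖w‖ ≤ 2 * inner ℝ w u →
          x + w ∈ Ω ∧ ‖f (x + w)‖ ≤ δ ∧ ∀ m ≤ k + 1, ‖iteratedFDeriv ℝ m f (x + w)‖ ≤ B) →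
        ∀ w : E4, ‖w‖ ≤ L * ((k + 1 - j) / (k + 1)) → ‖w‖ ≤ 2 * inner ℝ w u →
          ‖iteratedFDeriv ℝ j f (x + w)‖ ≤ ε := by
  have hk1 : (0 : ℝ) < k + 1 := by positivity
  intro j
  induction j with
  | zero =>
    intro _ ε hε
    refine ⟨ε, hε, fun f Ω x u _ _ _ hcone w hw hwu => ?_⟩
    have hwL : ‖w‖ ≤ L := by
      have h1 : L * ((k + 1 - ((0 : ℕ) : ℝ)) / (k + 1)) = L := by
        rw [Nat.cast_zero, sub_zero, div_self hk1.ne', mul_one]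
      exact hw.trans h1.le
    rw [norm_iteratedFDeriv_zero]
    exact (hcone w hwL hwu).2.1
  | succ j ih =>
    intro hjk
    have h1 : L * ((k + 1 - ((j + 1 : ℕ) : ℝ)) / (k + 1)) + L / (k + 1) ≤
        L * ((k + 1 - (j : ℝ)) / (k + 1)) := by
      push_cast
      apply le_of_eq
      field_simp
      ring
    have h2 : L * ((k + 1 - (j : ℝ)) / (k + 1)) ≤ L := by
      refine mul_le_of_le_one_right hL.le ?_
      rw [div_le_one hk1]
      linarith [(Nat.cast_nonneg j : (0 : ℝ) ≤ j)]
    exact coneInterp_succ hC0 hC hjk (τ := L / (k + 1)) (by positivity) h1 h2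
      (ih (Nat.le_of_succ_le hjk))

/-- **STUB 2b of line `birth` (uniform cone interpolation on `E4`, from the one-variable
endpoint inequality 2a).** Assuming the Landau-type inequality verbatim (for every `n ≥ 2` a
constant `C > 0` with `‖φ'(0)‖ ≤ C (A/T + B T^{n-1})` for `Cⁿ` curves on `[0, T]` bounded by `A`
with `n`-th derivative bounded by `B`): for every normed space `W`, order `k`, cone length
`L > 0`, bound `B` and `ε > 0` there is `δ > 0` such that for every `f : E4 → W` of class
`C^{k+1}` on an open `Ω`, every point `x` and unit vector `u` whose truncated cone
`x + {w | ‖w‖ ≤ L, ‖w‖ ≤ 2⟪w, u⟫}` lies in `Ω` and carries the bounds `‖f‖ ≤ δ`, `‖Dᵐ f‖ ≤ B`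
(`m ≤ k + 1`), all derivatives of order `≤ k` at `x` have operator norm `≤ ε`. Crude sup-norm
Gagliardo–Nirenberg interpolation on cones (Gagliardo 1959, Nirenberg 1959) in `ε`/`δ` form, via
the case `n = 2` of the hypothesis on segments: induction on the order with budget `L/(k + 1)`
per step (`coneInterp_level`), then the minimum of the finitely many `δ` and the vertex `w = 0`.
[folklore] -/
theorem stub_coneInterp :
    (∀ n : ℕ, 2 ≤ n → ∃ C : ℝ, 0 < C ∧
      ∀ (W : Type) [NormedAddCommGroup W] [NormedSpace ℝ W] (φ : ℝ → W) (T A B : ℝ), 0 < T →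
        (∀ t ∈ Set.Icc (0 : ℝ) T, ContDiffAt ℝ n φ t) →
        (∀ t ∈ Set.Icc (0 : ℝ) T, ‖φ t‖ ≤ A) →
        (∀ t ∈ Set.Icc (0 : ℝ) T, ‖iteratedDeriv n φ t‖ ≤ B) →
        ‖deriv φ 0‖ ≤ C * (A / T + B * T ^ (n - 1))) →
    ∀ (W : Type) [NormedAddCommGroup W] [NormedSpace ℝ W] (k : ℕ) (L B ε : ℝ), 0 < L → 0 < ε →
      ∃ δ : ℝ, 0 < δ ∧ ∀ (f : E4 → W) (Ω : Set E4) (x u : E4), IsOpen Ω →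
        ContDiffOn ℝ (k + 1) f Ω → ‖u‖ = 1 →
        (∀ w : E4, ‖w‖ ≤ L → ‖w‖ ≤ 2 * inner ℝ w u →
          x + w ∈ Ω ∧ ‖f (x + w)‖ ≤ δ ∧ ∀ m ≤ k + 1, ‖iteratedFDeriv ℝ m f (x + w)‖ ≤ B) →
        ∀ j ≤ k, ‖iteratedFDeriv ℝ j f x‖ ≤ ε := by
  intro hLandau W _ _ k L B ε hL hε
  obtain ⟨C, hC0, hC⟩ := hLandau 2 le_rfl
  -- the order-`2` instance of the hypothesis, with `T ^ (2 - 1) = T`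
  have hC' : ∀ (V : Type) [NormedAddCommGroup V] [NormedSpace ℝ V] (φ : ℝ → V) (T A B : ℝ),
      0 < T → (∀ t ∈ Set.Icc (0 : ℝ) T, ContDiffAt ℝ 2 φ t) →
        (∀ t ∈ Set.Icc (0 : ℝ) T, ‖φ t‖ ≤ A) →
        (∀ t ∈ Set.Icc (0 : ℝ) T, ‖iteratedDeriv 2 φ t‖ ≤ B) →
        ‖deriv φ 0‖ ≤ C * (A / T + B * T) := by
    intro V _ _ φ T A B' hT h1 h2 h3
    simpa using hC V φ T A B' hT (by simpa using h1) h2 h3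
  -- pointwise form of each level at the vertex `w = 0`
  have hpt : ∀ j : ℕ, j ≤ k → ∃ δ : ℝ, 0 < δ ∧ ∀ (f : E4 → W) (Ω : Set E4) (x u : E4),
      IsOpen Ω → ContDiffOn ℝ (k + 1) f Ω → ‖u‖ = 1 →
        (∀ w : E4, ‖w‖ ≤ L → ‖w‖ ≤ 2 * inner ℝ w u →
          x + w ∈ Ω ∧ ‖f (x + w)‖ ≤ δ ∧ ∀ m ≤ k + 1, ‖iteratedFDeriv ℝ m f (x + w)‖ ≤ B) →
        ‖iteratedFDeriv ℝ j f x‖ ≤ ε := by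
    intro j hj
    obtain ⟨δ, hδ, h⟩ := coneInterp_level (W := W) hC0 hC' k hL B j hj ε hε
    refine ⟨δ, hδ, fun f Ω x u hΩ hf hu hcone => ?_⟩
    have h0 : ‖(0 : E4)‖ ≤ L * ((k + 1 - (j : ℝ)) / (k + 1)) := by
      rw [norm_zero]
      refine mul_nonneg hL.le (div_nonneg ?_ (by positivity))
      have : (j : ℝ) ≤ k := by exact_mod_cast hj
      linarith
    simpa using h f Ω x u hΩ hf hu hcone 0 h0 (by simp)
  -- one `δ` for all orders `j ≤ J` (minimum of finitely many)
  have hcum : ∀ J : ℕ, ∃ δ : ℝ, 0 < δ ∧ ∀ j : ℕ, j ≤ J → j ≤ k →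
      ∀ (f : E4 → W) (Ω : Set E4) (x u : E4), IsOpen Ω → ContDiffOn ℝ (k + 1) f Ω → ‖u‖ = 1 →
        (∀ w : E4, ‖w‖ ≤ L → ‖w‖ ≤ 2 * inner ℝ w u →
          x + w ∈ Ω ∧ ‖f (x + w)‖ ≤ δ ∧ ∀ m ≤ k + 1, ‖iteratedFDeriv ℝ m f (x + w)‖ ≤ B) →
        ‖iteratedFDeriv ℝ j f x‖ ≤ ε := by
    intro J
    induction J with
    | zero =>
      obtain ⟨δ, hδ, h⟩ := hpt 0 (Nat.zero_le k)
      refine ⟨δ, hδ, fun j hj _ => ?_⟩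
      obtain rfl := Nat.le_zero.1 hj
      exact h
    | succ J ih =>
      obtain ⟨δ₁, hδ₁, h₁⟩ := ih
      by_cases hJk : J + 1 ≤ k
      · obtain ⟨δ₂, hδ₂, h₂⟩ := hpt (J + 1) hJk
        refine ⟨min δ₁ δ₂, lt_min hδ₁ hδ₂, fun j hj hjk f Ω x u hΩ hf hu hcone => ?_⟩
        rcases Nat.of_le_succ hj with hj' | rfl
        · exact h₁ j hj' hjk f Ω x u hΩ hf hu fun w hw hwu =>
            ⟨(hcone w hw hwu).1, (hcone w hw hwu).2.1.trans (min_le_left _ _),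
              (hcone w hw hwu).2.2⟩
        · exact h₂ f Ω x u hΩ hf hu fun w hw hwu =>
            ⟨(hcone w hw hwu).1, (hcone w hw hwu).2.1.trans (min_le_right _ _),
              (hcone w hw hwu).2.2⟩
      · exact ⟨δ₁, hδ₁, fun j hj hjk => h₁ j (by omega) hjk⟩
  obtain ⟨δ, hδ, h⟩ := hcum k
  exact ⟨δ, hδ, fun f Ω x u hΩ hf hu hcone j hj => h j hj hj f Ω x u hΩ hf hu hcone⟩

end Summit.FinalStateConjecture.FinalStateConjecture.Theorems.ClusterCompleteness
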